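import Summits.QuantumFields.QCD.Theses.HeatSlicedQuarks
import Literature.MathematicalPhysics.QuantumLattice.DuhamelTwoPoint

/-!
# Stub `stub_staircase` of line `Sketch` (idea `drop-the-wilson-square`)
(crux `Summit.QuantumFields.QCD.Theses.HeatSlicedQuarks.ActionBoundsLowModes`, item stmt-QuantumFields-8872,
route route-QuantumFields-HeatSlicedQuarks)

**Cwikel's dyadic staircase (high-energy part).**  Let `T ≻ 0` be a positive definite complex matrix
with spectral decomposition `T = V diag(λ) V⋆` (Mathlib's `eigenvectorUnitary` / `eigenvalues`,
`Matrix.IsHermitian.eq_conj_diagonal`), `W > 0` a weight, and put `c = V⋆ u`.  Sites and eigenvalues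
are sorted into dyadic (base `4`) classes `n(i) = Int.clog 4 (W i)` (so `W i ≤ 4^{n(i)}`) and
`m(k) = Int.log 4 (λ k)` (so `4^{m(k)} ≤ λ k`).  The "high" part
`Φ_hi u (i) = √W_i Σ_{k : m(k) ≥ n(i)+2} V_{ik} c_k` obeys `Σ_i |Φ_hi u (i)|² ≤ ¼ Re⟨u, T u⟩`.

Proof (formalised below, everything is elementary finite-dimensional linear algebra):
* `Re⟨u, T u⟩ = Σ_k λ_k |c_k|²` (`staircase_re_quadratic`) and `|√W_i z|² = W_i |z|²`, so the claim
  is the abstract estimate `staircase_core`: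
  `Σ_i W_i |Σ_{k : n(i)+2 ≤ m(k)} V_{ik} c_k|² ≤ ¼ Σ_k λ_k |c_k|²` for an isometry `V`, weights
  `W_i ≤ 4^{n(i)}` and `4^{m(k)} ≤ λ_k`.
* Step 1 (anti-diagonals): the inner sum is `Σ_{d ∈ D} x_d(i)` with
  `x_d(i) = Σ_{k : m(k) = n(i)+d} V_{ik} c_k` and `D` a finite set of integers `≥ 2` containing all
  differences `m(k) − n(i) ≥ 2`.
* Step 2 (Cauchy–Schwarz in `d`, `staircase_norm_sum_sq_le`, `staircase_geom_tail`):
  `|Σ_{d∈D} x_d(i)|² ≤ (Σ_{d∈D} 2^{-d}) Σ_{d∈D} 2^d |x_d(i)|² ≤ ½ Σ_{d∈D} 2^d |x_d(i)|²`.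
* Step 3 (the `d`-th anti-diagonal, `staircase_antidiag`): `Σ_i W_i |x_d(i)|² ≤ 4^{-d} Σ_k λ_k |c_k|²`:
  group the sites by their class `n(i) = n'`; there `W_i ≤ 4^{n'}` and `x_d(i) = (V c')_i` with the
  truncated vector `c'_k = [m(k) = n'+d] c_k`, so by the isometry property the class contributes at most
  `4^{n'} Σ_{k : m(k) = n'+d} |c_k|² ≤ 4^{-d} Σ_{k : m(k) = n'+d} λ_k |c_k|²`; the classes of `k` are
  disjoint.
* Step 4: `Σ_i W_i |Σ_d x_d(i)|² ≤ ½ Σ_{d∈D} 2^d 4^{-d} Σ_k λ_k |c_k|² = ½ (Σ_{d∈D} 2^{-d}) Σ_k λ_k|c_k|²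
  ≤ ¼ Σ_k λ_k |c_k|²`.
-/

namespace Summit.QuantumFields.QCD.Cruxes.ActionBoundsLowModes.DropTheWilsonSquare

open Matrix
open scoped ComplexOrder

/-! ## Small `ℓ²` helpers -/

/-- `Σ_i ‖v i‖² = Re⟨v, v⟩` for a complex vector `v`. -/
private theorem staircase_sum_norm_sq_eq_re {n : Type} [Fintype n] (v : n → ℂ) :
    ∑ i, ‖v i‖ ^ 2 = (star v ⬝ᵥ v).re := by
  rw [dotProduct, Complex.re_sum]
  refine Finset.sum_congr rfl fun i _ => ?_
  rw [Pi.star_apply, Complex.star_def, ← Complex.normSq_eq_conj_mul_self, Complex.ofReal_re,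
    Complex.normSq_eq_norm_sq]

/-- An isometry `A` (`Aᴴ A = 1`) preserves `Σ_i ‖v i‖²`. -/
private theorem staircase_sum_norm_sq_mulVec {n : Type} [Fintype n] [DecidableEq n]
    (A : Matrix n n ℂ) (hA : Aᴴ * A = 1) (v : n → ℂ) :
    ∑ i, ‖(A *ᵥ v) i‖ ^ 2 = ∑ i, ‖v i‖ ^ 2 := by
  rw [staircase_sum_norm_sq_eq_re, star_mulVec, ← dotProduct_mulVec, mulVec_mulVec, hA,
    one_mulVec, ← staircase_sum_norm_sq_eq_re]

/-- `Re (z̄ · (r z)) = r ‖z‖²` for real `r`. -/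
private theorem staircase_re_star_mul (z : ℂ) (r : ℝ) :
    (star z * ((r : ℂ) * z)).re = r * ‖z‖ ^ 2 := by
  rw [mul_left_comm, Complex.star_def, ← Complex.normSq_eq_conj_mul_self,
    Complex.normSq_eq_norm_sq, ← Complex.ofReal_mul, Complex.ofReal_re]

/-- The quadratic form in the eigenbasis: `Re⟨u, V diag(λ) Vᴴ u⟩ = Σ_k λ_k ‖(Vᴴ u)_k‖²`. -/
private theorem staircase_re_quadratic {n : Type} [Fintype n] [DecidableEq n]
    (V : Matrix n n ℂ) (lam : n → ℝ) (u : n → ℂ) :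
    (star u ⬝ᵥ ((V * diagonal (fun k => (lam k : ℂ)) * Vᴴ) *ᵥ u)).re =
      ∑ k, lam k * ‖(Vᴴ *ᵥ u) k‖ ^ 2 := by
  have hstar : star u ᵥ* V = star (Vᴴ *ᵥ u) := by
    rw [star_mulVec, conjTranspose_conjTranspose]
  rw [← mulVec_mulVec, ← mulVec_mulVec, dotProduct_mulVec, hstar, dotProduct, Complex.re_sum]
  refine Finset.sum_congr rfl fun k _ => ?_
  rw [mulVec_diagonal, Pi.star_apply, staircase_re_star_mul]

/-! ## Cauchy–Schwarz across the anti-diagonals and the geometric tail -/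

/-- Weighted Cauchy–Schwarz over a finite set of integers with weights `2^{∓d}`:
`‖Σ_{d∈s} a_d‖² ≤ (Σ_{d∈s} 2^{-d}) · Σ_{d∈s} 2^{d} ‖a_d‖²`. -/
private theorem staircase_norm_sum_sq_le (s : Finset ℤ) (a : ℤ → ℂ) :
    ‖∑ d ∈ s, a d‖ ^ 2 ≤ (∑ d ∈ s, (2:ℝ) ^ (-d)) * ∑ d ∈ s, (2:ℝ) ^ d * ‖a d‖ ^ 2 := by
  calc ‖∑ d ∈ s, a d‖ ^ 2 ≤ (∑ d ∈ s, ‖a d‖) ^ 2 := by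
        gcongr
        exact norm_sum_le _ _
    _ ≤ (∑ d ∈ s, (2:ℝ) ^ (-d)) * ∑ d ∈ s, (2:ℝ) ^ d * ‖a d‖ ^ 2 := by
        refine Finset.sum_sq_le_sum_mul_sum_of_sq_le_mul s (fun d _ => by positivity)
          (fun d _ => by positivity) (fun d _ => le_of_eq ?_)
        rw [← mul_assoc, _root_.zpow_neg, inv_mul_cancel₀ (zpow_ne_zero d two_ne_zero), one_mul]

/-- The geometric tail: `Σ_{d ∈ s} 2^{-d} ≤ ½` for a finite set `s` of integers `≥ 2`. -/
private theorem staircase_geom_tail (s : Finset ℤ) (hs : ∀ d ∈ s, 2 ≤ d) :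
    ∑ d ∈ s, (2:ℝ) ^ (-d) ≤ 1 / 2 := by
  -- re-index by the natural number `d.toNat`
  have hinj : ∀ x ∈ s, ∀ y ∈ s, Int.toNat x = Int.toNat y → x = y := by
    intro x hx y hy hxy
    have h1 := hs x hx
    have h2 := hs y hy
    omega
  have hpt : ∀ d ∈ s, (2:ℝ) ^ (-d) = (1 / 2 : ℝ) ^ (Int.toNat d) := by
    intro d hd
    have hd0 : ((Int.toNat d : ℕ) : ℤ) = d := Int.toNat_of_nonneg (by have := hs d hd; omega)
    rw [one_div, inv_pow, ← zpow_natCast, hd0, _root_.zpow_neg]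
  set t : Finset ℕ := s.image Int.toNat with ht
  have hsub : t ⊆ Finset.Ico 2 (t.sup id + 1) := by
    intro j hj
    rw [Finset.mem_Ico]
    refine ⟨?_, Nat.lt_succ_of_le (Finset.le_sup (f := id) hj)⟩
    obtain ⟨d, hd, rfl⟩ := Finset.mem_image.mp hj
    have := hs d hd
    omega
  calc ∑ d ∈ s, (2:ℝ) ^ (-d) = ∑ d ∈ s, (1 / 2 : ℝ) ^ (Int.toNat d) := Finset.sum_congr rfl hpt
    _ = ∑ j ∈ t, (1 / 2 : ℝ) ^ j := (Finset.sum_image hinj).symm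
    _ ≤ ∑ j ∈ Finset.Ico 2 (t.sup id + 1), (1 / 2 : ℝ) ^ j :=
        Finset.sum_le_sum_of_subset_of_nonneg hsub fun j _ _ => by positivity
    _ ≤ (1 / 2 : ℝ) ^ 2 / (1 - 1 / 2) := geom_sum_Ico_le_of_lt_one (by norm_num) (by norm_num)
    _ = 1 / 2 := by norm_num

/-! ## The `d`-th anti-diagonal -/

/-- **Step 3.** For an isometry `V`, weights `0 ≤ W_i ≤ 4^{n(i)}`, `4^{m(k)} ≤ λ_k` and any integer `d`:
`Σ_i W_i |Σ_{k : m(k) = n(i)+d} V_{ik} c_k|² ≤ 4^{-d} Σ_k λ_k |c_k|²`. -/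
private theorem staircase_antidiag {n : Type} [Fintype n] [DecidableEq n] (V : Matrix n n ℂ)
    (hV : Vᴴ * V = 1) (lam W : n → ℝ) (mcls ncls : n → ℤ)
    (hWle : ∀ i, W i ≤ (4:ℝ) ^ ncls i) (hlam : ∀ k, (4:ℝ) ^ mcls k ≤ lam k) (c : n → ℂ) (d : ℤ) :
    ∑ i, W i * ‖∑ k, (if mcls k = ncls i + d then V i k * c k else 0)‖ ^ 2 ≤
      (4:ℝ) ^ (-d) * ∑ k, lam k * ‖c k‖ ^ 2 := by
  have hlam0 : ∀ k, 0 ≤ lam k := fun k => ((zpow_pos (by norm_num) _).le.trans (hlam k))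
  -- the classes of sites
  set S : Finset ℤ := (Finset.univ : Finset n).image ncls with hS
  have hmaps : ∀ i ∈ (Finset.univ : Finset n), ncls i ∈ S := fun i _ =>
    Finset.mem_image_of_mem ncls (Finset.mem_univ i)
  -- on the class `n(i) = n'` the inner sum is `(V c') i` for the truncated vector `c'`
  have hfib : ∀ (n' : ℤ) (i : n), ncls i = n' →
      W i * ‖∑ k, (if mcls k = ncls i + d then V i k * c k else 0)‖ ^ 2 ≤
        (4:ℝ) ^ n' * ‖(V *ᵥ fun k => if mcls k = n' + d then c k else 0) i‖ ^ 2 := by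
    intro n' i hi
    have heq : ∑ k, (if mcls k = ncls i + d then V i k * c k else 0) =
        (V *ᵥ fun k => if mcls k = n' + d then c k else 0) i := by
      simp only [mulVec, dotProduct, mul_ite, mul_zero, hi]
    rw [heq]
    exact mul_le_mul_of_nonneg_right (hi ▸ hWle i) (sq_nonneg _)
  -- per-class bound
  have hclass : ∀ n' ∈ S,
      ∑ i ∈ Finset.univ.filter (fun i => ncls i = n'),
          W i * ‖∑ k, (if mcls k = ncls i + d then V i k * c k else 0)‖ ^ 2 ≤
        (4:ℝ) ^ (-d) * ∑ k, (if mcls k = n' + d then lam k * ‖c k‖ ^ 2 else 0) := by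
    intro n' _
    obtain ⟨c', hc'⟩ : ∃ c' : n → ℂ, c' = fun k => if mcls k = n' + d then c k else 0 := ⟨_, rfl⟩
    calc ∑ i ∈ Finset.univ.filter (fun i => ncls i = n'),
          W i * ‖∑ k, (if mcls k = ncls i + d then V i k * c k else 0)‖ ^ 2
        ≤ ∑ i ∈ Finset.univ.filter (fun i => ncls i = n'), (4:ℝ) ^ n' * ‖(V *ᵥ c') i‖ ^ 2 :=
          Finset.sum_le_sum fun i hi => hc' ▸ hfib n' i (Finset.mem_filter.mp hi).2
      _ ≤ ∑ i, (4:ℝ) ^ n' * ‖(V *ᵥ c') i‖ ^ 2 :=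
          Finset.sum_le_sum_of_subset_of_nonneg (Finset.subset_univ _) fun i _ _ => by positivity
      _ = (4:ℝ) ^ n' * ∑ k, ‖c' k‖ ^ 2 := by
          rw [← Finset.mul_sum, staircase_sum_norm_sq_mulVec V hV c']
      _ = (4:ℝ) ^ n' * ∑ k, (if mcls k = n' + d then ‖c k‖ ^ 2 else 0) := by
          congr 1
          refine Finset.sum_congr rfl fun k _ => ?_
          by_cases hk : mcls k = n' + d <;> simp [hc', hk]
      _ ≤ (4:ℝ) ^ (-d) * ∑ k, (if mcls k = n' + d then lam k * ‖c k‖ ^ 2 else 0) := by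
          rw [Finset.mul_sum, Finset.mul_sum]
          refine Finset.sum_le_sum fun k _ => ?_
          split_ifs with hk
          · have h4 : (4:ℝ) ^ n' = (4:ℝ) ^ (-d) * (4:ℝ) ^ mcls k := by
              rw [hk, ← zpow_add₀ (by norm_num : (4:ℝ) ≠ 0)]
              congr 1
              ring
            rw [h4, mul_assoc]
            exact mul_le_mul_of_nonneg_left (mul_le_mul_of_nonneg_right (hlam k) (sq_nonneg _))
              (zpow_nonneg (by norm_num) _)
          · simp
  -- sum over the classes
  calc ∑ i, W i * ‖∑ k, (if mcls k = ncls i + d then V i k * c k else 0)‖ ^ 2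
      = ∑ n' ∈ S, ∑ i ∈ Finset.univ.filter (fun i => ncls i = n'),
          W i * ‖∑ k, (if mcls k = ncls i + d then V i k * c k else 0)‖ ^ 2 :=
        (Finset.sum_fiberwise_of_maps_to hmaps _).symm
    _ ≤ ∑ n' ∈ S, (4:ℝ) ^ (-d) * ∑ k, (if mcls k = n' + d then lam k * ‖c k‖ ^ 2 else 0) :=
        Finset.sum_le_sum hclass
    _ = (4:ℝ) ^ (-d) * ∑ k, ∑ n' ∈ S, (if mcls k = n' + d then lam k * ‖c k‖ ^ 2 else 0) := by
        rw [← Finset.mul_sum, Finset.sum_comm]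
    _ ≤ (4:ℝ) ^ (-d) * ∑ k, lam k * ‖c k‖ ^ 2 := by
        refine mul_le_mul_of_nonneg_left (Finset.sum_le_sum fun k _ => ?_)
          (zpow_nonneg (by norm_num) _)
        have hiff : ∀ n' : ℤ, (mcls k = n' + d) ↔ (n' = mcls k - d) := fun n' => by omega
        simp_rw [hiff, Finset.sum_ite_eq']
        split_ifs
        · exact le_rfl
        · exact mul_nonneg (hlam0 k) (sq_nonneg _)

/-! ## The abstract staircase bound -/

/-- **Steps 1, 2, 4.** For an isometry `V`, weights `0 ≤ W_i ≤ 4^{n(i)}` and `4^{m(k)} ≤ λ_k`: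
`Σ_i W_i |Σ_{k : n(i)+2 ≤ m(k)} V_{ik} c_k|² ≤ ¼ Σ_k λ_k |c_k|²`. -/
private theorem staircase_core {n : Type} [Fintype n] [DecidableEq n] (V : Matrix n n ℂ)
    (hV : Vᴴ * V = 1) (lam W : n → ℝ) (mcls ncls : n → ℤ) (hW : ∀ i, 0 ≤ W i)
    (hWle : ∀ i, W i ≤ (4:ℝ) ^ ncls i) (hlam : ∀ k, (4:ℝ) ^ mcls k ≤ lam k) (c : n → ℂ) :
    ∑ i, W i * ‖∑ k, (if ncls i + 2 ≤ mcls k then V i k * c k else 0)‖ ^ 2 ≤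
      1 / 4 * ∑ k, lam k * ‖c k‖ ^ 2 := by
  have hlam0 : ∀ k, 0 ≤ lam k := fun k => ((zpow_pos (by norm_num) _).le.trans (hlam k))
  have hQ0 : 0 ≤ ∑ k, lam k * ‖c k‖ ^ 2 :=
    Finset.sum_nonneg fun k _ => mul_nonneg (hlam0 k) (sq_nonneg _)
  -- the finite set of relevant anti-diagonals `d = m(k) - n(i) ≥ 2`
  obtain ⟨D, hD2, hDmem⟩ : ∃ D : Finset ℤ, (∀ d ∈ D, 2 ≤ d) ∧
      ∀ i k, ncls i + 2 ≤ mcls k → mcls k - ncls i ∈ D := by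
    refine ⟨((Finset.univ : Finset (n × n)).image (fun p => mcls p.2 - ncls p.1)).filter
      (fun d => 2 ≤ d), fun d hd => (Finset.mem_filter.mp hd).2, fun i k hik => ?_⟩
    exact Finset.mem_filter.mpr ⟨Finset.mem_image.mpr ⟨(i, k), Finset.mem_univ _, rfl⟩, by omega⟩
  -- the anti-diagonal pieces `x_d(i)`
  obtain ⟨x, hx⟩ : ∃ x : ℤ → n → ℂ,
      ∀ d i, x d i = ∑ k, (if mcls k = ncls i + d then V i k * c k else 0) := ⟨_, fun _ _ => rfl⟩
  -- Step 1
  have hstep1 : ∀ i, ∑ k, (if ncls i + 2 ≤ mcls k then V i k * c k else 0) = ∑ d ∈ D, x d i := by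
    intro i
    simp_rw [hx]
    rw [Finset.sum_comm]
    refine Finset.sum_congr rfl fun k _ => ?_
    have hiff : ∀ d : ℤ, (mcls k = ncls i + d) ↔ (d = mcls k - ncls i) := fun d => by omega
    simp_rw [hiff, Finset.sum_ite_eq']
    by_cases h : ncls i + 2 ≤ mcls k
    · rw [if_pos h, if_pos (hDmem i k h)]
    · rw [if_neg h, if_neg (fun hm => h (by have := hD2 _ hm; omega))]
  -- Step 2
  have hstep2 : ∀ i, ‖∑ d ∈ D, x d i‖ ^ 2 ≤ 1 / 2 * ∑ d ∈ D, (2:ℝ) ^ d * ‖x d i‖ ^ 2 :=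
    fun i => (staircase_norm_sum_sq_le D (fun d => x d i)).trans
      (mul_le_mul_of_nonneg_right (staircase_geom_tail D hD2)
        (Finset.sum_nonneg fun d _ => by positivity))
  -- Step 3
  have hstep3 : ∀ d ∈ D, ∑ i, W i * ‖x d i‖ ^ 2 ≤ (4:ℝ) ^ (-d) * ∑ k, lam k * ‖c k‖ ^ 2 := by
    intro d _
    simp_rw [hx]
    exact staircase_antidiag V hV lam W mcls ncls hWle hlam c d
  have h24 : ∀ d : ℤ, (2:ℝ) ^ d * (4:ℝ) ^ (-d) = (2:ℝ) ^ (-d) := fun d => by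
    rw [show (4:ℝ) = 2 * 2 by norm_num, mul_zpow, ← mul_assoc, _root_.zpow_neg,
      mul_inv_cancel₀ (zpow_ne_zero d two_ne_zero), one_mul]
  -- Step 4
  calc ∑ i, W i * ‖∑ k, (if ncls i + 2 ≤ mcls k then V i k * c k else 0)‖ ^ 2
      = ∑ i, W i * ‖∑ d ∈ D, x d i‖ ^ 2 := by simp_rw [hstep1]
    _ ≤ ∑ i, W i * (1 / 2 * ∑ d ∈ D, (2:ℝ) ^ d * ‖x d i‖ ^ 2) :=
        Finset.sum_le_sum fun i _ => mul_le_mul_of_nonneg_left (hstep2 i) (hW i)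
    _ = 1 / 2 * ∑ d ∈ D, (2:ℝ) ^ d * ∑ i, W i * ‖x d i‖ ^ 2 := by
        simp only [Finset.mul_sum]
        rw [Finset.sum_comm]
        exact Finset.sum_congr rfl fun d _ => Finset.sum_congr rfl fun i _ => by ring
    _ ≤ 1 / 2 * ∑ d ∈ D, (2:ℝ) ^ d * ((4:ℝ) ^ (-d) * ∑ k, lam k * ‖c k‖ ^ 2) := by
        gcongr with d hd
        exact hstep3 d hd
    _ = 1 / 2 * (∑ d ∈ D, (2:ℝ) ^ (-d)) * ∑ k, lam k * ‖c k‖ ^ 2 := by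
        rw [mul_assoc, Finset.sum_mul]
        congr 1
        refine Finset.sum_congr rfl fun d _ => ?_
        rw [← mul_assoc, h24]
    _ ≤ 1 / 2 * (1 / 2) * ∑ k, lam k * ‖c k‖ ^ 2 :=
        mul_le_mul_of_nonneg_right
          (mul_le_mul_of_nonneg_left (staircase_geom_tail D hD2) (by norm_num)) hQ0
    _ = 1 / 4 * ∑ k, lam k * ‖c k‖ ^ 2 := by norm_num

/-! ## The stub -/

/-- **Stub C1a (`stub_staircase`, Cwikel's staircase: the high-energy part has norm ≤ ½).**
Let `T ≻ 0` with eigen-decomposition `T = V diag(λ) V⋆` (Mathlib's `eigenvectorUnitary`,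
`eigenvalues`), `W > 0` a weight, dyadic classes `m(k) = Int.log 4 (λ_k)` (`4^{m(k)} ≤ λ_k < 4^{m(k)+1}`),
`n(i) = Int.clog 4 (W_i)` (`4^{n(i)-1} < W_i ≤ 4^{n(i)}`), and `c = V⋆u`.  Then the "high" part
`Φ_hi u (i) = √W_i Σ_{k : m(k) ≥ n(i)+2} V_{ik} c_k` satisfies `Σ_i |Φ_hi u (i)|² ≤ ¼ Re⟨u, T u⟩`.
Proof sketch: split by the anti-diagonal `d = m(k) − n(i) ≥ 2`; Cauchy–Schwarz in `d` with weights `2^{∓d}`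
(`Σ_{d≥2} 2^{-d} = ½`); for fixed `d`, group the sites by `n(i) = n`: `W_i ≤ 4ⁿ`, `V` is an isometry, and
`|c_k|² ≤ 4^{-(n+d)} λ_k |c_k|²` on the class `m(k) = n+d`; summing, `Σ_i W_i |x_d(i)|² ≤ 4^{-d} Σ_k λ_k|c_k|²`
and `Σ_k λ_k |c_k|² = Re⟨u,Tu⟩`; finally `½ Σ_{d≥2} 2^d 4^{-d} = ¼`. -/
theorem stub_staircase :
    ∀ {n : Type} [Fintype n] [DecidableEq n] (T : Matrix n n ℂ) (hT : T.PosDef) (W : n → ℝ),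
      (∀ i, 0 < W i) → ∀ (u : n → ℂ),
        ∑ i, ‖(Real.sqrt (W i) : ℂ) *
            ∑ k, (if Int.clog 4 (W i) + 2 ≤ Int.log 4 (hT.1.eigenvalues k) then
              (hT.1.eigenvectorUnitary : Matrix n n ℂ) i k *
                ((star (hT.1.eigenvectorUnitary : Matrix n n ℂ)) *ᵥ u) k else 0)‖ ^ 2 ≤
          (1 / 4 : ℝ) * (star u ⬝ᵥ (T *ᵥ u)).re := by
  intro n _ _ T hT W hW u
  set V : Matrix n n ℂ := (hT.1.eigenvectorUnitary : Matrix n n ℂ) with hVdef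
  set lam : n → ℝ := hT.1.eigenvalues with hlamdef
  have hVu : V ∈ unitary (Matrix n n ℂ) := hT.1.eigenvectorUnitary.prop
  have hVV : Vᴴ * V = 1 := by
    rw [← star_eq_conjTranspose]
    exact Unitary.star_mul_self_of_mem hVu
  have hTeq : T = V * diagonal (fun k => (lam k : ℂ)) * Vᴴ := by
    rw [← star_eq_conjTranspose]
    exact hT.1.eq_conj_diagonal
  have hlam : ∀ k, (4:ℝ) ^ Int.log 4 (lam k) ≤ lam k := fun k => by
    have h := Int.zpow_log_le_self (b := 4) (by norm_num) (hT.eigenvalues_pos k)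
    simpa using h
  have hWle : ∀ i, W i ≤ (4:ℝ) ^ Int.clog 4 (W i) := fun i => by
    have h := Int.self_le_zpow_clog (R := ℝ) (b := 4) (by norm_num) (W i)
    simpa using h
  have hlhs : ∀ (i : n) (z : ℂ), ‖(Real.sqrt (W i) : ℂ) * z‖ ^ 2 = W i * ‖z‖ ^ 2 := fun i z => by
    rw [norm_mul, Complex.norm_real, Real.norm_of_nonneg (Real.sqrt_nonneg _), mul_pow,
      Real.sq_sqrt (hW i).le]
  have hrhs : (star u ⬝ᵥ (T *ᵥ u)).re = ∑ k, lam k * ‖(Vᴴ *ᵥ u) k‖ ^ 2 := by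
    rw [hTeq]
    exact staircase_re_quadratic V lam u
  simp_rw [hlhs]
  rw [hrhs, star_eq_conjTranspose]
  exact staircase_core V hVV lam W (fun k => Int.log 4 (lam k)) (fun i => Int.clog 4 (W i))
    (fun i => (hW i).le) hWle hlam (Vᴴ *ᵥ u)

end Summit.QuantumFields.QCD.Cruxes.ActionBoundsLowModes.DropTheWilsonSquare
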